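import Summits.QuantumFields.YangMills.Theorems.BalabanUVNodesN15KingModelGraphTreeDecayEngine
import Summits.QuantumFields.YangMills.Theorems.BalabanUVNodesN15KingModelGraphPowerCountingLowered

/-!
# BalabanUVNodes ∕ N15 — THE KING-MODEL RUNG (PART Α-c): THE EXPONENTIAL TREE DECAY OF (3.56) — THE STRIP LEMMA («extracting a small part of each
# propagator»: every slice keeps at least unit-scale decay, so half of Prop. 3.7's `δ₀` can be given away), the replacement step WITH THE DECAY EXTRACTED on
# the typer's `TwoSpacing` record, and the stripped letters for King's fine slices read through the pairing
# (Track A, DAG node N15 = NE2; FAN-OUT v1.1 §N15 s3 «KING-MODEL RUNG … NE2's analogue DECIDED in the model»)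

HONEST FRAMING.  Count-neutral (cell `pub-ymgap`, seat `pub-ymgap-dag-n15-e` g29; `--supports stmt-QuantumFields-27366 --as helper` = K3⁸
`SpineGivenEndpointR13SepCoPHV`).  TEMPLATE LITERATURE: C. King, *The U(1) Higgs model. I. The continuum limit*, Commun. Math. Phys. **102** (1986) 649–677
[King1986], Proposition 3.6 (3.56) p. 662 and its proof p. 664; Proposition 3.7 (3.63) p. 663; Proposition 3.9 (3.73) p. 665 — on the typer's schemas
`King1986.SlicePropagator.TwoSpacing`∕`Prop37PrintedAt`∕`Prop39PrintedAt` (Literature, hypotheses BY NAME) and on King's `A = 0` slice datum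
`kingSliceKernels` (part Ρ-e).  NOT Bałaban's `G(U)` of [B9]; NOT a node discharge; nothing continuum ∕ ℝ⁴ ∕ OS ∕ mass-gap ∕ Clay.  0 `sorry`; standard axioms.
Text layer of pp. 662–665 (`paper:king1986-cmp102-king-u1-higgs-i` p0014–p0017) re-read by this seat 2026-08-29.

THE PRINT.  p. 664 [PDF 16], verbatim: *«By extracting a small part of each propagator, we get the exponential decay on the right-hand side of (3.56). Let x, y
be the endpoints of the graph H₁ = l(1); there is a factor exp[−δ₀L^{k−j_{l(1)}}|x − y|] present. … where δ₁ is a fraction of δ₀ chosen so that after all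
these transfers there is some decay left on l(1).»*; Prop. 3.7 (3.63) p. 663: *«|G^η_{(j)}(x, y)|, |∂^η_μG^η_{(j)}(x, y)| ≤ C{(L^jη)^{2−d}, (L^jη)^{1−d}}·
exp[−δ₀(L^jη)^{−1}|x − y|] … Furthermore, if we replace G^η_{(j)} by G^{η′}_{(j)} throughout … the bounds are valid»*; Prop. 3.9 (3.73) p. 665 with
*«exp[−δ₀(L^jη)^{−1}|x − y|]»* read at the paired points `x = pt x′`.

READING (declared; ours).  THE STRIP LEMMA: a slice of length `s = L^jη ≤ 1` decays at the rate `δ₀s^{−1} ≥ δ₀` per unit length, so for `0 ≤ δ ≤ δ₀∕2`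
`C s^e e^{−δ₀ρ∕s} ≤ C s^e e^{−(δ₀∕2)ρ∕s}·e^{−δρ}` (`ρ ≥ 0`): the profile with HALF the rate times the unit-scale «small part» `e^{−δρ}` — uniformly in the
slice.  Applied to the sizes (3.63) on both lattices (the fine one read at the paired coarse points, as part Η-b's `hhi` and (3.73) do) and to the rates (3.73),
it feeds part Α-a's weighted engine with stripped majorants = the SAME profiles at `δ₀∕2`; the weights are `exp[−δ|x − y|]` on the lines and the user's
`ϑ_υ` on the one-vertex factors.  For King's FINE slices in their own currency (the `S^c` terms of Prop. 3.6's proof, part Γ-e) the weight read through the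
pairing costs `e^{δη} ≤ e^{δ₀∕2}` (part Χ-a `mul_tdistT_kingSlicePt_le`: `|pt x′ − pt y′| ≤ |x′ − y′| + η`).

WHAT THIS FILE PROVES.
* §1 (namespace `…N15KingModelRung.Graph`, the typer's record `T : TwoSpacing d`): `exp_strip_le` (the strip lemma), `slice_le_one` (`j + 1 ≤ k ⇒ L^jη ≤ 1`),
  ★ `sizeProfile_le_strip`, ★ `rateProfile_le_strip` ((3.63)∕(3.73)-profiles at `δ₀` ≤ the same at `δ₀∕2` times `e^{−δ|x − y|}`), ★★★
  **`graph_replacement_twoSpacing_decay`** — PART Η-b's `graph_replacement_twoSpacing_reduced` WITH THE DECAY EXTRACTED: under `Prop37PrintedAt α T.lo C δ₀`,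
  the fine sizes through the pairing, `Prop39PrintedAt α T C δ₀ γ`, slices `≤ 1`, `dist ≥ 0`, stripped one-vertex majorants `p_υ`, `q_υ` with positive weights
  `ϑ_υ`, and `Π_ℓ e^{−δ·dist(σ(src ℓ), σ(tgt ℓ))}·Π_υ ϑ_υ(σ(vtx υ)) ≤ Θ₀` at every coarse placement:
  `‖E_hi − E_lo‖ ≤ Θ₀·(L^{−γk}·Σ_ℓ 𝔼(sizeProfile_{C,δ₀∕2}[ℓ ↦ reducedProfile_{C,δ₀∕2,γ}]; p) + Σ_υ 𝔼(sizeProfile_{C,δ₀∕2}; p[υ ↦ q_υ]))`.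
* §2 (namespace `…N15KingModelRung.Curved`, King's tori): ★ `profileAt_le_strip` (part Γ-d's profile), ★★ **`abs_sliceLine_mul_exp_le_profileAt`** — the
  `(K+n)`-run's slice `c` (Prop. 3.7 «Furthermore» by name) TIMES the coarse-read weight `exp[+δ|pt x′ − pt y′|]` is bounded by the fine profile at
  `(C e^{δ₀∕2}, δ₀∕2)`: the stripped majorant of the `S^c` terms; its sup ∕ vertex sums are part Γ-d's `profileAt_le_sup` ∕ `lineSum_profileAt_row∕col` VERBATIM.

HONEST SCOPE.  (a) Letters only; the assembly (parts Α-d–Α-f) consumes them with part Α-b's tree length as `Θ₀ = exp[−δ·treeLength]`.  (b) The Hölder clauses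
(3.65)∕(3.75) are untouched (not needed by the replacement step as typed).  (c) Halving `δ₀` is a choice (any fraction would do; King: «δ₁ is a fraction of δ₀»).
Locators: [King1986] p.664 («By extracting a small part of each propagator …», «δ₁ is a fraction of δ₀»), Prop. 3.7 (3.63) p.663, Prop. 3.9 (3.73) p.665,
p.664 (pairing «x′ ∈ B^n(x)»).
-/

noncomputable section

/-! ## §1 The strip lemma and the replacement step with the decay extracted, on the typer's record -/

namespace Summit.QuantumFields.YangMills.BalabanUVNodes.N15KingModelRung.Graph

open scoped BigOperators
open Finset
open Literature.MathematicalPhysics.QuantumFieldTheory.King1986.SlicePropagator (SliceKernels TwoSpacing Prop37PrintedAt Prop39PrintedAt)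

/-- ★ **THE STRIP LEMMA** — «extracting a small part of each propagator»: a slice of length `0 < s ≤ 1` decays at rate `δ₀s^{−1} ≥ δ₀` per unit length, so for
`0 ≤ δ ≤ δ₀∕2` and `ρ ≥ 0`, `e^{−δ₀s^{−1}ρ} ≤ e^{−(δ₀∕2)s^{−1}ρ}·e^{−δρ}`. [cite: King1986, p.664 («By extracting a small part of each propagator, we get the
exponential decay … δ₁ is a fraction of δ₀ chosen so that … there is some decay left»)] -/
theorem exp_strip_le {δ₀ δ s ρ : ℝ} (hδ₀ : 0 ≤ δ₀) (hδ2 : δ ≤ δ₀ / 2) (hs0 : 0 < s) (hs1 : s ≤ 1) (hρ : 0 ≤ ρ) :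
    Real.exp (-(δ₀ * s⁻¹ * ρ)) ≤ Real.exp (-(δ₀ / 2 * s⁻¹ * ρ)) * Real.exp (-(δ * ρ)) := by
  rw [← Real.exp_add]
  refine Real.exp_le_exp.2 ?_
  have h1s : 1 ≤ s⁻¹ := (one_le_inv₀ hs0).2 hs1
  have h1 : δ * ρ ≤ δ₀ / 2 * ρ := mul_le_mul_of_nonneg_right hδ2 hρ
  have h2 : δ₀ / 2 * ρ ≤ δ₀ / 2 * ρ * s⁻¹ := le_mul_of_one_le_right (by positivity) h1s
  nlinarith [h1, h2]

/-- **every slice of (2.17) is at most the unit scale**: `j + 1 ≤ k ⇒ L^jη = L^j∕L^k ≤ 1` (`L ≥ 1`). [cite: King1986, (2.17) p.653, (3.63) p.663] -/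
theorem slice_le_one {dd : ℕ} (D : SliceKernels dd) (hL : 1 ≤ D.L) {j : ℕ} (hj : j + 1 ≤ D.k) : D.slice j ≤ 1 := by
  have hL1 : (1 : ℝ) ≤ D.L := by exact_mod_cast hL
  unfold SliceKernels.slice SliceKernels.η Literature.MathematicalPhysics.QuantumFieldTheory.King1986.ContinuumLimit.eps
  rw [← div_eq_mul_inv]
  exact div_le_one_of_le₀ (pow_le_pow_right₀ hL1 (by omega)) (by positivity)

variable {d : ℕ} (T : TwoSpacing d)

/-- ★ **THE (3.63)-PROFILE STRIPPED**: `sizeProfile_{C,δ₀} ≤ sizeProfile_{C,δ₀∕2}·e^{−δ|x − y|}` for `0 ≤ δ ≤ δ₀∕2`, slices `≤ 1`, `|x − y| ≥ 0`.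
[cite: King1986, Prop. 3.7 (3.63) p.663, p.664 («extracting a small part of each propagator»)] -/
theorem sizeProfile_le_strip (hL : 1 ≤ T.lo.L) (hdist : ∀ x y, 0 ≤ T.lo.dist x y) {C δ₀ δ : ℝ} (hC : 0 ≤ C) (hδ₀ : 0 ≤ δ₀) (hδ2 : δ ≤ δ₀ / 2)
    {j : ℕ} (hj : j + 1 ≤ T.lo.k) (κ : Option (Fin d)) (x y : T.lo.S) :
    sizeProfile T C δ₀ j κ x y ≤ sizeProfile T C (δ₀ / 2) j κ x y * Real.exp (-(δ * T.lo.dist x y)) := by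
  have hs : 0 < T.lo.slice j := T.lo.slice_pos (by omega) j
  unfold sizeProfile
  rw [mul_assoc (C * T.lo.slice j ^ lineExp d κ)]
  exact mul_le_mul_of_nonneg_left (exp_strip_le hδ₀ hδ2 hs (slice_le_one T.lo hL hj) (hdist x y)) (mul_nonneg hC (Real.rpow_nonneg hs.le _))

/-- ★ **THE (3.73)-PROFILE STRIPPED**: `rateProfile_{C,δ₀,γ} ≤ rateProfile_{C,δ₀∕2,γ}·e^{−δ|x − y|}` under the same conditions. [cite: King1986, Prop. 3.9 (3.73)
p.665, p.664] -/
theorem rateProfile_le_strip (hL : 1 ≤ T.lo.L) (hdist : ∀ x y, 0 ≤ T.lo.dist x y) {C δ₀ δ : ℝ} (hC : 0 ≤ C) (hδ₀ : 0 ≤ δ₀) (hδ2 : δ ≤ δ₀ / 2)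
    (γ : ℝ) {j : ℕ} (hj : j + 1 ≤ T.lo.k) (κ : Option (Fin d)) (x y : T.lo.S) :
    rateProfile T C δ₀ γ j κ x y ≤ rateProfile T C (δ₀ / 2) γ j κ x y * Real.exp (-(δ * T.lo.dist x y)) := by
  have hL0 : (0 : ℝ) < T.lo.L := by exact_mod_cast (show 0 < T.lo.L by omega)
  have hs : 0 < T.lo.slice j := T.lo.slice_pos (by omega) j
  unfold rateProfile
  rw [mul_assoc (C * (T.lo.L : ℝ) ^ (-(γ * T.lo.k)) * T.lo.slice j ^ (lineExp d κ - γ))]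
  exact mul_le_mul_of_nonneg_left (exp_strip_le hδ₀ hδ2 hs (slice_le_one T.lo hL hj) (hdist x y))
    (mul_nonneg (mul_nonneg hC (Real.rpow_nonneg hL0.le _)) (Real.rpow_nonneg hs.le _))

/-- the (3.73)-profile is nonnegative (`C ≥ 0`, `L ≥ 1`). [cite: King1986, (3.73) p.665] -/
theorem rateProfile_nonneg (hL : 0 < T.lo.L) {C : ℝ} (hC : 0 ≤ C) (δ₀ γ : ℝ) (j : ℕ) (κ : Option (Fin d)) (x y : T.lo.S) :
    0 ≤ rateProfile T C δ₀ γ j κ x y := by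
  have hL0 : (0 : ℝ) ≤ T.lo.L := Nat.cast_nonneg _
  rw [rateProfile_eq]
  exact mul_nonneg (Real.rpow_nonneg hL0 _) (reducedProfile_nonneg T hC hL δ₀ γ j κ x y)

variable {V Λ Υ : Type*} [Fintype V] [DecidableEq V] [Fintype Λ] [DecidableEq Λ] [Fintype Υ] [DecidableEq Υ]
  [Fintype T.lo.S] [DecidableEq T.lo.S] [Fintype T.hi.S]

/-- ★★★ **THE REPLACEMENT STEP WITH «A SMALL PART OF EACH PROPAGATOR» EXTRACTED, ON THE TYPER's RECORD.**  HYPOTHESES (all by name on `T : TwoSpacing d`):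
`Prop37PrintedAt α T.lo C δ₀` (sizes (3.63) of the coarse slices), the fine sizes in coarse currency through the pairing (`hhi`, Prop. 3.7 «Furthermore»),
`Prop39PrintedAt α T C δ₀ γ` (rates (3.73)), `L ≥ 1`, coarse distances `≥ 0`, uniform fibres of the pairing (`#pt⁻¹(x) = m`, `m·w′ = w`); one-vertex factors
with STRIPPED sizes `p_υ` and rates `q_υ` against positive weights `ϑ_υ` (both lattices, through the pairing); `0 ≤ δ ≤ δ₀∕2`; and the weight bound
`Π_ℓ e^{−δ·dist(σ(src ℓ), σ(tgt ℓ))}·Π_υ ϑ_υ(σ(vtx υ)) ≤ Θ₀` at EVERY coarse placement (part Α-b: `Θ₀ = e^{−δ·treeLength}` for a connected graph).  CONCLUSION: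
`‖E_hi(H(j)) − E_lo(H(j))‖ ≤ Θ₀·(L^{−γk}·Σ_ℓ 𝔼(sizeProfile_{C,δ₀∕2}[ℓ ↦ reducedProfile_{C,δ₀∕2,γ}]; p) + Σ_υ 𝔼(sizeProfile_{C,δ₀∕2}; p[υ ↦ q_υ]))` — part Η-b's
conclusion at HALF the decay rate, times the extracted weight bound.  PROOF: part Α-a's weighted engine with the line weights `e^{−δ|x − y|}`; the stripped
sizes ∕ rates are the strip lemma applied to (3.63) ∕ `hhi` ∕ (3.73), all three read at coarse points. [cite: King1986, p.664 («By extracting a small part of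
each propagator, we get the exponential decay on the right-hand side of (3.56)»), pp.664–665 (the replacement step), Prop. 3.7 (3.63) p.663, Prop. 3.9 (3.73) p.665] -/
theorem graph_replacement_twoSpacing_decay (hL : 1 ≤ T.lo.L) (hdist : ∀ x y, 0 ≤ T.lo.dist x y)
    {α C δ₀ γ δ : ℝ} (hC : 0 ≤ C) (hδ₀ : 0 ≤ δ₀) (hδ2 : δ ≤ δ₀ / 2)
    (h37 : Prop37PrintedAt α T.lo C δ₀)
    (hhi : ∀ j : ℕ, j + 1 ≤ T.lo.k → ∀ (κ : Option (Fin d)) (x' y' : T.hi.S),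
      ‖hiLine T j κ x' y'‖ ≤ sizeProfile T C δ₀ j κ (T.pt x') (T.pt y'))
    (h39 : Prop39PrintedAt α T C δ₀ γ)
    {m : ℕ} (hfib : ∀ x : T.lo.S, (univ.filter fun x' : T.hi.S => T.pt x' = x).card = m) {w w' : ℝ} (hw : (m : ℝ) * w' = w)
    (src tgt : Λ → V) (js : Λ → ℕ) (hjs : ∀ ℓ, js ℓ + 1 ≤ T.lo.k) (κ : Λ → Option (Fin d)) (vtx : Υ → V)
    (u : Υ → T.lo.S → ℝ) (u' : Υ → T.hi.S → ℝ) (ϑ p q : Υ → T.lo.S → ℝ)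
    (hϑ : ∀ υ x, 0 < ϑ υ x) (hp0 : ∀ υ x, 0 ≤ p υ x) (hq0 : ∀ υ x, 0 ≤ q υ x)
    (hp : ∀ υ x, ‖u υ x‖ ≤ p υ x * ϑ υ x) (hp' : ∀ υ x', ‖u' υ x'‖ ≤ p υ (T.pt x') * ϑ υ (T.pt x'))
    (hq : ∀ υ x', ‖u' υ x' - u υ (T.pt x')‖ ≤ q υ (T.pt x') * ϑ υ (T.pt x')) {Θ₀ : ℝ}
    (hΘ : ∀ σ : V → T.lo.S, (∏ ℓ, Real.exp (-(δ * T.lo.dist (σ (src ℓ)) (σ (tgt ℓ))))) * ∏ υ, ϑ υ (σ (vtx υ)) ≤ Θ₀) :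
    ‖graphValLS w' src tgt (fun ℓ => hiLine T (js ℓ) (κ ℓ)) vtx u' - graphValLS w src tgt (fun ℓ => loLine T (js ℓ) (κ ℓ)) vtx u‖
      ≤ Θ₀ * ((T.lo.L : ℝ) ^ (-(γ * T.lo.k))
            * ∑ ℓ, graphValLS ‖w‖ src tgt
                (Function.update (fun ℓ => sizeProfile T C (δ₀ / 2) (js ℓ) (κ ℓ)) ℓ (reducedProfile T C (δ₀ / 2) γ (js ℓ) (κ ℓ))) vtx p
          + ∑ υ, graphValLS ‖w‖ src tgt (fun ℓ => sizeProfile T C (δ₀ / 2) (js ℓ) (κ ℓ)) vtx (Function.update p υ (q υ))) := by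
  have hL0 : 0 < T.lo.L := by omega
  have h := norm_graphValLS_sub_le_of_weight (𝕜 := ℝ) T.pt hfib (by exact_mod_cast hw) src tgt vtx
    (fun ℓ => loLine T (js ℓ) (κ ℓ)) (fun ℓ => hiLine T (js ℓ) (κ ℓ))
    (fun _ x y => Real.exp (-(δ * T.lo.dist x y)))
    (fun ℓ => sizeProfile T C (δ₀ / 2) (js ℓ) (κ ℓ)) (fun ℓ => rateProfile T C (δ₀ / 2) γ (js ℓ) (κ ℓ))
    (fun _ _ _ => Real.exp_pos _) (fun ℓ x y => sizeProfile_nonneg T hC hL0 _ _ _ x y) (fun ℓ x y => rateProfile_nonneg T hL0 hC _ _ _ _ x y)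
    (fun ℓ x y => (loLine_le_sizeProfile T h37 (hjs ℓ) (κ ℓ) x y).trans (sizeProfile_le_strip T hL hdist hC hδ₀ hδ2 (hjs ℓ) (κ ℓ) x y))
    (fun ℓ x' y' => (hhi (js ℓ) (hjs ℓ) (κ ℓ) x' y').trans (sizeProfile_le_strip T hL hdist hC hδ₀ hδ2 (hjs ℓ) (κ ℓ) _ _))
    (fun ℓ x' y' => (hiLine_sub_loLine_le_rateProfile T h39 (hjs ℓ) (κ ℓ) x' y').trans
      (rateProfile_le_strip T hL hdist hC hδ₀ hδ2 γ (hjs ℓ) (κ ℓ) _ _))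
    u u' ϑ p q hϑ hp0 hq0 hp hp' hq hΘ
  refine h.trans (le_of_eq ?_)
  congr 2
  rw [mul_sum]
  refine sum_congr rfl fun ℓ _ => ?_
  have hr : rateProfile T C (δ₀ / 2) γ (js ℓ) (κ ℓ) = fun x y => (T.lo.L : ℝ) ^ (-(γ * T.lo.k)) * reducedProfile T C (δ₀ / 2) γ (js ℓ) (κ ℓ) x y :=
    funext fun x => funext fun y => rateProfile_eq T C (δ₀ / 2) γ (js ℓ) (κ ℓ) x y
  rw [hr, graphValLS_line_update_mul]

end Summit.QuantumFields.YangMills.BalabanUVNodes.N15KingModelRung.Graph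

/-! ## §2 King's tori: the profile stripped; the fine slices stripped through the pairing -/

namespace Summit.QuantumFields.YangMills.BalabanUVNodes.N15KingModelRung.Curved

open scoped BigOperators
open Finset
open Literature.MathematicalPhysics.QuantumFieldTheory.Balaban1983to89.B5Prop11Plancherel (Tor fine)
open Literature.MathematicalPhysics.QuantumFieldTheory.King1986.Torus (tdistT tdistT_nonneg)
open Literature.MathematicalPhysics.QuantumFieldTheory.King1986.SlicePropagator (SliceKernels Prop37PrintedAt)
open Literature.MathematicalPhysics.QuantumFieldTheory.King1986.ContinuumLimit (eps)
open Summit.QuantumFields.YangMills.BalabanUVNodes.N15KingModelRung.Graph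

variable {d : ℕ} (L : ℕ) [NeZero L]

/-- ★ **PART Γ-d's PROFILE STRIPPED**: `profileAt_{C,δ₀}(c, ex) ≤ profileAt_{C,δ₀∕2}(c, ex)·e^{−δ|x − y|∕L^k}` for every slice `c + 1 ≤ k` (length `L^cη ≤ 1`),
`0 ≤ δ ≤ δ₀∕2`. [cite: King1986, (3.63) p.663, p.664 («extracting a small part of each propagator»)] -/
theorem profileAt_le_strip (hL : 1 ≤ L) {k : ℕ} (M : Fin (d + 1) → ℕ) [∀ μ, NeZero (M μ)] {C δ₀ δ : ℝ} (hC : 0 ≤ C) (hδ₀ : 0 ≤ δ₀) (hδ2 : δ ≤ δ₀ / 2)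
    {c : ℕ} (hc : c + 1 ≤ k) (ex : ℝ) (x y : Tor (fine (L ^ k) M)) :
    profileAt L k M C δ₀ c ex x y ≤ profileAt L k M C (δ₀ / 2) c ex x y * Real.exp (-(δ * (tdistT (fine (L ^ k) M) x y / (L : ℝ) ^ k))) := by
  have hL0 : (0 : ℝ) < L := by exact_mod_cast (show 0 < L by omega)
  have hL1 : (1 : ℝ) ≤ L := by exact_mod_cast hL
  have hs : 0 < (L : ℝ) ^ c * eps L k := by unfold eps; positivity
  have hs1 : (L : ℝ) ^ c * eps L k ≤ 1 := by
    unfold eps; rw [← div_eq_mul_inv]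
    exact div_le_one_of_le₀ (pow_le_pow_right₀ hL1 (by omega)) (by positivity)
  have hρ : 0 ≤ tdistT (fine (L ^ k) M) x y / (L : ℝ) ^ k := div_nonneg (tdistT_nonneg _ x y) (pow_nonneg hL0.le _)
  unfold profileAt
  rw [mul_assoc (C * ((L : ℝ) ^ c * eps L k) ^ ex)]
  exact mul_le_mul_of_nonneg_left (exp_strip_le hδ₀ hδ2 hs hs1 hρ) (mul_nonneg hC (Real.rpow_nonneg hs.le _))

/-- ★★ **THE `(K+n)`-RUN's SLICES STRIPPED THROUGH THE PAIRING** (the majorants of the `S^c` terms with the decay extracted): under Prop. 3.7 «Furthermore»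
for the fine datum (`Prop37PrintedAt α (kingSliceKernels L (K+n) …) C δ₀`, part Ρ by name), for every slice `c + 1 ≤ K + n`, kind, pair and `0 ≤ δ ≤ δ₀∕2`:
`|G^{η′}_{(c)}(x′, y′)|·exp[+δ|pt x′ − pt y′|] ≤ profileAt_{C e^{δ₀∕2}, δ₀∕2}(c)(x′, y′)` — the strip lemma on the fine lattice plus part Χ-a's pairing defect
`L^n|x − y| ≤ |x′ − y′| + L^n − 1` (`|pt x′ − pt y′| ≤ |x′ − y′| + η`, cost `e^{δη} ≤ e^{δ₀∕2}`).  Its sup and vertex sums are part Γ-d's `profileAt_le_sup`,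
`lineSum_profileAt_row∕col` at `(C e^{δ₀∕2}, δ₀∕2)`. [cite: King1986, Prop. 3.7 (3.63) p.663 («Furthermore …»), p.664 (pairing; «extracting a small part»)] -/
theorem abs_sliceLine_mul_exp_le_profileAt (hL : 2 ≤ L) {a msq : ℝ} {K n eM : ℕ} (hK : 1 ≤ K) (M : Fin (d + 1) → ℕ) [∀ μ, NeZero (M μ)]
    (hM : ∀ μ, M μ = 2 * L ^ eM) {α C δ₀ δ : ℝ} (hC : 0 ≤ C) (hδ₀ : 0 ≤ δ₀) (hδ : 0 ≤ δ) (hδ2 : δ ≤ δ₀ / 2)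
    (h37' : Prop37PrintedAt α (kingSliceKernels L (K + n) eM M hM (one_le_add_of_one_le hK n) a msq) C δ₀)
    {c : ℕ} (hc : c + 1 ≤ K + n) (κ : Option (Fin (d + 1))) (x' y' : Tor (fine (L ^ (K + n)) M)) :
    |sliceLine (kingSliceKernels L (K + n) eM M hM (one_le_add_of_one_le hK n) a msq) c κ x' y'|
        * Real.exp (δ * (tdistT (fine (L ^ K) M) (kingSlicePt L K n M x') (kingSlicePt L K n M y') / (L : ℝ) ^ K))
      ≤ profileAt L (K + n) M (C * Real.exp (δ₀ / 2)) (δ₀ / 2) c (lineExp (d + 1) κ) x' y' := by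
  have hL0 : (0 : ℝ) < L := by exact_mod_cast (show 0 < L by omega)
  have hL1 : (1 : ℝ) ≤ L := by exact_mod_cast (show 1 ≤ L by omega)
  obtain ⟨h1, -, -⟩ := h37' c hc
  -- Prop. 3.7 for the fine slice, in the fine lattice's letters
  set s : ℝ := (L : ℝ) ^ c * eps L (K + n) with hsdef
  set ρ' : ℝ := tdistT (fine (L ^ (K + n)) M) x' y' / (L : ℝ) ^ (K + n) with hρ'
  set ρ : ℝ := tdistT (fine (L ^ K) M) (kingSlicePt L K n M x') (kingSlicePt L K n M y') / (L : ℝ) ^ K with hρdef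
  have hpt : |sliceLine (kingSliceKernels L (K + n) eM M hM (one_le_add_of_one_le hK n) a msq) c κ x' y'|
      ≤ C * s ^ lineExp (d + 1) κ * Real.exp (-(δ₀ * s⁻¹ * ρ')) := by
    rcases κ with _ | μ
    · exact (h1 x' y').1
    · exact (h1 x' y').2 μ
  have hs : 0 < s := by rw [hsdef]; unfold eps; positivity
  have hs1 : s ≤ 1 := by
    rw [hsdef]; unfold eps; rw [← div_eq_mul_inv]
    exact div_le_one_of_le₀ (pow_le_pow_right₀ hL1 (by omega)) (by positivity)
  have hρ'0 : 0 ≤ ρ' := div_nonneg (tdistT_nonneg _ x' y') (pow_nonneg hL0.le _)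
  -- the pairing defect: `ρ ≤ ρ' + η`, `η = L^{−K} ≤ 1`
  have hdef : ρ - ((L : ℝ) ^ K)⁻¹ ≤ ρ' := by
    have h := mul_tdistT_kingSlicePt_le L K n M x' y'
    push_cast at h
    have hKp : (0 : ℝ) < (L : ℝ) ^ K := pow_pos hL0 _
    have hnp : (0 : ℝ) < (L : ℝ) ^ n := pow_pos hL0 _
    rw [hρdef, hρ']
    calc tdistT (fine (L ^ K) M) (kingSlicePt L K n M x') (kingSlicePt L K n M y') / (L : ℝ) ^ K - ((L : ℝ) ^ K)⁻¹
        = ((L : ℝ) ^ n * tdistT (fine (L ^ K) M) (kingSlicePt L K n M x') (kingSlicePt L K n M y') - (L : ℝ) ^ n) / ((L : ℝ) ^ K * (L : ℝ) ^ n) := by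
          field_simp
      _ ≤ tdistT (fine (L ^ (K + n)) M) x' y' / ((L : ℝ) ^ K * (L : ℝ) ^ n) := div_le_div_of_nonneg_right (by linarith) (by positivity)
      _ = tdistT (fine (L ^ (K + n)) M) x' y' / (L : ℝ) ^ (K + n) := by rw [← pow_add]
  have hη1 : ((L : ℝ) ^ K)⁻¹ ≤ 1 := inv_le_one_of_one_le₀ (one_le_pow₀ hL1)
  have hw : Real.exp (δ * ρ) ≤ Real.exp (δ * ρ') * Real.exp (δ₀ / 2) := by
    rw [← Real.exp_add]
    refine Real.exp_le_exp.2 ?_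
    have h1 : δ * ρ ≤ δ * ρ' + δ * ((L : ℝ) ^ K)⁻¹ := by nlinarith [mul_le_mul_of_nonneg_left hdef hδ]
    have h2 : δ * ((L : ℝ) ^ K)⁻¹ ≤ δ₀ / 2 := (mul_le_of_le_one_right hδ hη1).trans hδ2
    linarith
  -- assemble
  have hCs : 0 ≤ C * s ^ lineExp (d + 1) κ := mul_nonneg hC (Real.rpow_nonneg hs.le _)
  have hstrip : Real.exp (-(δ₀ * s⁻¹ * ρ')) * Real.exp (δ * ρ') ≤ Real.exp (-(δ₀ / 2 * s⁻¹ * ρ')) := by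
    have h := exp_strip_le hδ₀ hδ2 hs hs1 hρ'0
    calc Real.exp (-(δ₀ * s⁻¹ * ρ')) * Real.exp (δ * ρ')
        ≤ Real.exp (-(δ₀ / 2 * s⁻¹ * ρ')) * Real.exp (-(δ * ρ')) * Real.exp (δ * ρ') := mul_le_mul_of_nonneg_right h (Real.exp_nonneg _)
      _ = Real.exp (-(δ₀ / 2 * s⁻¹ * ρ')) := by rw [mul_assoc, ← Real.exp_add, neg_add_cancel, Real.exp_zero, mul_one]
  calc |sliceLine (kingSliceKernels L (K + n) eM M hM (one_le_add_of_one_le hK n) a msq) c κ x' y'| * Real.exp (δ * ρ)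
      ≤ C * s ^ lineExp (d + 1) κ * Real.exp (-(δ₀ * s⁻¹ * ρ')) * (Real.exp (δ * ρ') * Real.exp (δ₀ / 2)) :=
        mul_le_mul hpt hw (Real.exp_nonneg _) (mul_nonneg hCs (Real.exp_nonneg _))
    _ = (C * Real.exp (δ₀ / 2)) * s ^ lineExp (d + 1) κ * (Real.exp (-(δ₀ * s⁻¹ * ρ')) * Real.exp (δ * ρ')) := by ring
    _ ≤ (C * Real.exp (δ₀ / 2)) * s ^ lineExp (d + 1) κ * Real.exp (-(δ₀ / 2 * s⁻¹ * ρ')) :=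
        mul_le_mul_of_nonneg_left hstrip (mul_nonneg (mul_nonneg hC (Real.exp_nonneg _)) (Real.rpow_nonneg hs.le _))
    _ = profileAt L (K + n) M (C * Real.exp (δ₀ / 2)) (δ₀ / 2) c (lineExp (d + 1) κ) x' y' := by
        rw [hsdef, hρ']; unfold profileAt; rfl

end Summit.QuantumFields.YangMills.BalabanUVNodes.N15KingModelRung.Curved

end
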